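import Literature.MathematicalPhysics.QuantumFieldTheory.Balaban1983to89.B9Eq365QGGQFlatCarrierDictionary

/-!
# `Balaban1983to89.B9Eq365QGGQFlatSymbolTransfer` — T. Bałaban, *Propagators and renormalization transformations for lattice gauge theories. I*,
# Commun. Math. Phys. **95** (1984) 17–40 [Balaban1984PropagatorsI] (1.45) p. 26 and p. 25 (the paragraph after (1.44)) with T. Bałaban, *Propagators for
# lattice gauge theories in a background field*, Commun. Math. Phys. **99** (1985) 389–434 [Balaban1985BackgroundPropagators] Thm 3.11 p. 416, (3.25) p. 394:
# **THE CARRIER DICTIONARY (J-M-α), PART 2 — b05's KERNEL-CHECKED MULTIPLIER WINDOW `γ₀ ≦ Q′_kG′_k²Q′_k^*` ((1.45) AS AN OPERATOR INEQUALITY ON THE FINITE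
# TORUS, `B5QGGQ145Bounds`) TRANSPORTED ONTO THE NE9 CHAIN's THIRD OPERATOR `Q̃′G′(1)²Q̃′†` OF THM 3.11 AT THE FLAT BACKGROUND:
# `γ·(ηL)⁴·(c₁∕(c₀L^{d+1}))·‖ψ‖² ≤ re⟪ψ, Q̃′G′(1)²Q̃′†ψ⟫` for every `γ ≤ ev_{L,a,m}`, hence on the diagonal `(min_k ev)·‖ψ‖² ≤ …` (the EXACT flat constant
# `κ(1)`) and ONE `γ₀(d, a₋, a₊) > 0` FOR ALL `L`, ALL VOLUMES, ALL `a′ ∈ [a₋, a₊]`**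

statement-level skeleton of published theorems with citation tags; proofs where landed; nothing here is a claim about the Yang–Mills mass gap

CITATION HEADER (lean-in-tree rule).  Audit cell `pub-balaban`, sub-cell `t4`, BINDER row NE9; filed by NE9 formalisation-swarm LEAF PROVER 01
(`b2b-balaban-t4-ne9-formalise-leaf-01`, gen 81) as part 2 of the junction **(J-M-α)** of `t4/ROUTES-NE9.md` v13.31 ADDENDUM (iv) (t4-ne9-idea-1 gen 94;
first refusal this lineage; deliverable: «the one-sided `min_k B5QGGQ145Bounds.ev L a′ N k · ‖ψ‖² ≤ Re⟪ψ, Q̃′G′(1)²Q̃′†ψ⟫` … on `SiteL2K ℂ d m c₁ W` by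
transporting `form_qggq_re` …»).  Part 1 = `B9Eq365QGGQFlatCarrierDictionary` (the intertwiners).  Consumer: the `hκ1` slot of ne9-leaf-06's
`B9Eq325RLipschitzClosed` (route R2′ STEP B7′ S3c), served so far by the variational floors `B9Eq365QGGQLowerVariational(Sharp)`.  Sources READ: [B5′] pp. 25–26 through the cell's audited headers (`B5QGGQ145Torus`, `B5QGGQ145Bounds`,
lit-balaban b05-g7); [B9] pp. 394, 416 in the held text (`paper:balaban1985-cmp99-background-propagators`, journal page = PDF page + 388).

THE PRINT (verbatim).  [B5′] p. 25: *«It is enough to prove that Q′_kG′_k²Q′_k^* is positive definite. This operator is of course nonnegative and if for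
some ω defined on T₁^{(k)} we have ⟨ω, Q′_kG′_k²Q′_k^*ω⟩ = ‖G′_kQ′_k^*ω‖² = 0, then Q′_k^*ω = 0, hence ω = 0. We have bounds 0 < Q′_kG′_k²Q′_k^* ≦ a^{−2},
and they imply the existence of the inverse operator and a bound from below.»*  p. 26, after (1.45): *«From this representation and from the bounds (2.51),
(2.52) of that paper, it follows that there are positive constants γ₀, γ₁, in fact γ₀ dependent only on d, γ₁ = a^{−2}, such that
γ₀ ≦ Q′_kG′_k²Q′_k^* ≦ γ₁.»*  [B9] p. 416: *«Theorem 3.11. Under the assumptions of the Theorems 3.1–3.10 … the operators Δ′_a, G′, (Q′G′²Q′*)⁻¹, Δ_a, G are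
positive definite. This is obvious for the first three operators …»* — the size of the lower bound of `Q′G′²Q′*` is the cell's `ev_window` ∕
`qggq_operator_bounds` (k- and volume-uniform; HONEST SCOPE there: "γ₀ dependent only on d" NOT asserted, "γ₁ = a⁻²" refuted for large `a`).

WHAT IS PROVED (sorry-free; 0 `def`; axioms standard; [folklore] finite-dimensional bookkeeping on top of the two cells' theorems; nothing of [B5′]∕[B9]
newly asserted).  Letters: `Q̃′ := (WL2.linearEquiv ℂ ℂ (fun _ ↦ c₁)).symm ∘ₗ QprimeW L m φ 1`, `G′(1) := GpOfU L m φ η 1 a′ hpos′`, `a := a′(ηL)²c₁∕(c₀L^{d+1})`,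
`ω_w(z′) := (ηL)²(c₁∕(c₀L^{d+1}))·⟪w, ψ(perSite m z′)⟫`.
* §4 **`green_component_eq_GQ`** (`η ≠ 0`, `a′ > 0`): `z ↦ ⟪w, (G′(1)Q̃′†ψ)(perSite (L·m) z)⟫ = B5QGGQ145Torus.GQ L a 0 m ω_w` — the chain's Green operator
  and b05's `G′Q′^*` AGREE componentwise (both sides are `(L·m)`-periodic solutions of `opD L a 0 (·) = Q′^*ω_w`: `apply_greenK` + part 1 §3, resp. `opD_GQ`;
  `B4TorusPositivity.torusGreen_existsUnique`).
* §5 `sum_norm_sq_GQ_window` (b05's `gram_qggq` + `form_qggq_bounds`: `L^{d+1}γΣ_{T₁}|ω|² ≤ Σ_{T_ξ}|G′Q′^*ω|² ≤ L^{d+1}ΓΣ_{T₁}|ω|²` for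
  `γ ≤ ev ≤ Γ`), `sum_univ_eq_sum_box_perSite`; **`norm_sq_green_adjoint_window`** (`η ≠ 0`: `γ(ηL)⁴(c₁∕(c₀L^{d+1}))‖ψ‖² ≤ ‖G′(1)Q̃′†ψ‖² ≤ Γ(ηL)⁴(…)‖ψ‖²`;
  fibre `W` split over `stdOrthonormalBasis`, `OrthonormalBasis.sum_sq_norm_inner_right`); **`qggq_flat_symbol_transfer`**: for every `γ` with
  `∀ k, γ ≤ ev L a m k` and every coarse `ψ`, `γ(ηL)⁴(c₁∕(c₀L^{d+1}))‖ψ‖² ≤ re⟪ψ, (Q̃′∘G′(1)∘G′(1)∘Q̃′†)ψ⟫` — the operator of `qggq_coercive_flat`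
  VERBATIM (`η = 0` trivially); `qggq_flat_symbol_transfer_upper` (the two-sided companion `≤ Γ(ηL)⁴(…)‖ψ‖²`, `η ≠ 0`);
  **`qggq_flat_symbol_transfer_diagonal`** (`ηL = 1`, `c₀L^{d+1} = c₁`: `γ‖ψ‖² ≤ …` for `γ ≤ ev L a′ m`); **`qggq_flat_min_ev_le`** (the exact flat
  constant `min_k ev_{L,a′,m}(k)` as a typed `Finset.inf'`);
  **`qggq_flat_symbol_transfer_one`** ∕ `…_one_diagonal` (`hpos′` DISCHARGED by `B9Thm311DeltaPrimeA.laplacePrimeA_one_pos`; the operator of ne9-leaf-06's `QGGQ_pos_one`, resp. LITERALLY the `hκ1` slot of `B9Eq325RLipschitzClosed.norm_RofU_sub_RofU_one_le_of_letters` with `κ₀ := γ`);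
  **`exists_uniform_qggq_flat_lower_bound`** (b05's `ev_window`: ONE `γ₀(d, a₋, a₊) > 0` for ALL `L ≥ 1`, ALL `m`, ALL `a′ ∈ [a₋, a₊]`, on the diagonal).
MODEL ∕ HONEST SCOPE.  Flat background only; the constants are b05's (existential `γ₀` from `B5Strip145Leaves.uniformStrip145_holds`; the exact one is the
typed minimum of `ev`, no digits here — balaban-calc's KAPPA1 target per v13.31 (iv)); general `η`, `c₀`, `c₁` enter only through `(ηL)` and
`c₁∕(c₀L^{d+1})`; both sides of b05's window are transferred; the identity `κ(1) = min_k ev` (attainment) is not typed.  NOT NE9, NOT the route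
(cell pub-balaban: NE9 NOT PRINTED ∕ NOT PROVED; «NE9 ⇐ the named binders»; row WALLED ON A MODEL (O-NE9-1; #5 UNRULED); spine PROVED 0∕9; rung (B)+1 on a
finite T⁴ — NOT infinite volume, NOT mass gap, NOT Clay; HONEST DEPENDENCY: continuum YM on T⁴ ⇐ BetaPertH ∧ nine spine estimates (0/9 proved); BetaPertH ⇐
(D1) ∧ (D4) ∧ CAP+tail; G-an2-4 gates asym, D1 and NE2/3/4).  NEW file importing part 1 only; nothing modified.  Net new unproved facts: 0.
-/

noncomputable section

open scoped BigOperators InnerProductSpace ComplexConjugate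

namespace Literature.MathematicalPhysics.QuantumFieldTheory.Balaban1983to89.B9Eq365QGGQFlatSymbolTransfer

open B4Sect5Torus (TSite)
open B9SectCLatticeCarrier (Bond)
open B9Eq311L2Pairing (WL2)
open B9Eq319QprimeTorus (fineP blockCoord)
open B11Eq103H1Complex (SiteL2K greenK apply_greenK)
open B5Eq172HodgePositivity (hRS_one)
open B9Eq326OperatorAssembly (QprimeW)
open B9Eq3119DeltaPiCarrier (laplacePrimeA GpOfU)
open B9Eq325ProjFormula (laplacePrimeA_isSymmetric)
open B9Thm311DeltaPrimeA (laplacePrimeA_one_pos)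
open B9Eq365QGGQLowerVariational (inner_qggq_eq_norm_sq)
open B9Eq315QTorus (perSite)
open B9Eq315QTorusOnto (liftSite perSite_liftSite)
open B4Green244 (coarse finePt opD finePt_coarse_offset coarse_finePt)
open B4TorusPositivity (box IsPeriodic wrap wrap_mem_box period_pos torusGreen_existsUnique)
open B5QGGQ145Torus (GQ GQ_isPeriodic opD_GQ gram_qggq qggq)
open B5QGGQ145Bounds (ev form_qggq_bounds ev_window)
open B9Eq365QGGQFlatCarrierDictionary (one_le_period isPeriodic_comp_perSite sum_box_eq_sum_liftSite coarse_mem_box blockCoord_perSite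
  equiv_adjoint_QprimeWL2_one inner_laplacePrimeA_one_perSite)

variable {d : ℕ}

/-! ## §4 The Green's functions agree: the components of `G′(1)Q̃′(1)†ψ` read on `ℤ^{d+1}` ARE b05's `G′Q′^*ω` (uniqueness on the torus) -/

section Green

variable (L : ℕ) [NeZero L] (m : Fin (d + 1) → ℕ) [∀ i, NeZero (m i)] [∀ i, NeZero (fineP L m i)]
  {𝔸 : Type*} [Ring 𝔸] [Algebra ℂ 𝔸] {W : Type*} [NormedAddCommGroup W] [InnerProductSpace ℂ W] [FiniteDimensional ℂ W]
  (φ : W ≃ₗ[ℂ] 𝔸) (c₀ : ℝ) [Fact (0 < c₀)] (η : ℝ) (c₁ : ℝ) [Fact (0 < c₁)]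

/-- **THE COMPONENTS OF `u = G′(1)Q̃′(1)†ψ` ARE b05's `G′Q′^*ω_w`**: for `η ≠ 0`, `a′ > 0`, every `w ∈ W` and every coarse `ψ`,
`z ↦ ⟪w, u(z mod L·m)⟫ = B5QGGQ145Torus.GQ L a 0 m ω_w` with `a = a′(ηL)²c₁∕(c₀L^{d+1})` and `ω_w(z′) = (ηL)²(c₁∕(c₀L^{d+1}))·⟪w, ψ(z′ mod m)⟫` —
both are `(L·m)`-periodic solutions of `opD L a 0 (·) = Q′^*ω_w` (`apply_greenK` + §3 on the chain side, `opD_GQ` on b05's), and the torus Green operator is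
unique (`B4TorusPositivity.torusGreen_existsUnique`). [cite: Balaban1984PropagatorsI, p.25 (paragraph after (1.44)); Balaban1985BackgroundPropagators, (3.24)–(3.25) p.394; Balaban1983RegularityDecay, (1.6) p.572] -/
theorem green_component_eq_GQ (hη : η ≠ 0) {a' : ℝ} (ha' : 0 < a')
    (hpos' : ∀ x : SiteL2K ℂ (d + 1) (fineP L m) c₀ W, x ≠ 0 →
      0 < RCLike.re ⟪x, laplacePrimeA L m φ η (fun _ : Bond (d + 1) (fineP L m) => (1 : 𝔸ˣ)) a' (c₁ := c₁) x⟫_ℂ)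
    (ψ : SiteL2K ℂ (d + 1) m c₁ W) (w : W) :
    (fun z => ⟪w, WL2.equiv ℂ _ W (GpOfU L m φ η (fun _ : Bond (d + 1) (fineP L m) => (1 : 𝔸ˣ)) a' (c₁ := c₁) hpos'
        (LinearMap.adjoint ((WL2.linearEquiv ℂ ℂ (fun _ : TSite (d + 1) m => c₁)).symm.toLinearMap ∘ₗ
          QprimeW L m φ (fun _ : Bond (d + 1) (fineP L m) => (1 : 𝔸ˣ)) (c₀ := c₀)) ψ)) (perSite (fineP L m) z)⟫_ℂ) =
      GQ L (a' * (η * L) ^ 2 * (c₁ / (c₀ * (L : ℝ) ^ (d + 1)))) 0 m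
        (fun z' => ((((η * L) ^ 2 * (c₁ / (c₀ * (L : ℝ) ^ (d + 1)))) : ℝ) : ℂ) * ⟪w, WL2.equiv ℂ _ W ψ (perSite m z')⟫_ℂ) := by
  have hc₀ : 0 < c₀ := Fact.out
  have hc₁ : 0 < c₁ := Fact.out
  have hL0 : (0 : ℝ) < L := by exact_mod_cast Nat.pos_of_ne_zero (NeZero.ne L)
  have hL1 : 1 ≤ L := Nat.one_le_iff_ne_zero.mpr (NeZero.ne L)
  have hN : ∀ i, 1 ≤ m i := one_le_period m
  have hηL : (η * L) ^ 2 ≠ 0 := pow_ne_zero _ (mul_ne_zero hη hL0.ne')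
  set A : ℝ := a' * (η * L) ^ 2 * (c₁ / (c₀ * (L : ℝ) ^ (d + 1))) with hA
  have hA0 : 0 < A := by rw [hA]; positivity
  set Qℓ := (WL2.linearEquiv ℂ ℂ (fun _ : TSite (d + 1) m => c₁)).symm.toLinearMap ∘ₗ
    QprimeW L m φ (fun _ : Bond (d + 1) (fineP L m) => (1 : 𝔸ˣ)) (c₀ := c₀) with hQℓ
  set u := GpOfU L m φ η (fun _ : Bond (d + 1) (fineP L m) => (1 : 𝔸ˣ)) a' (c₁ := c₁) hpos' (LinearMap.adjoint Qℓ ψ) with hu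
  set F : (Fin (d + 1) → ℤ) → ℂ := fun z => ⟪w, WL2.equiv ℂ _ W u (perSite (fineP L m) z)⟫_ℂ with hF
  set ω : (Fin (d + 1) → ℤ) → ℂ :=
    fun z' => ((((η * L) ^ 2 * (c₁ / (c₀ * (L : ℝ) ^ (d + 1)))) : ℝ) : ℂ) * ⟪w, WL2.equiv ℂ _ W ψ (perSite m z')⟫_ℂ with hω
  -- `Δ′u = Q̃′†ψ`
  have hTu : laplacePrimeA L m φ η (fun _ : Bond (d + 1) (fineP L m) => (1 : 𝔸ˣ)) a' (c₀ := c₀) (c₁ := c₁) u = LinearMap.adjoint Qℓ ψ :=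
    apply_greenK hpos' _
  -- hence `opD L A 0 F = Q′^*ω` on all of `ℤ^{d+1}` (componentwise reading of §3)
  have hDF : ∀ z, opD L A 0 F z = ω (coarse L z) := by
    intro z
    have h := inner_laplacePrimeA_one_perSite L m φ c₀ η c₁ hη a' u w z
    rw [hTu, hQℓ, equiv_adjoint_QprimeWL2_one, inner_smul_right, blockCoord_perSite] at h
    -- `h : ρ⁻¹·⟪w, ψ(⌊z∕L⌋ mod m)⟫ = (ηL)⁻²·opD F z`
    have e : opD L A 0 F z = ((((η * L) ^ 2 : ℝ)) : ℂ) * (((((η * L) ^ 2)⁻¹ : ℝ) : ℂ) * opD L A 0 F z) := by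
      rw [← mul_assoc, ← Complex.ofReal_mul, mul_inv_cancel₀ hηL, Complex.ofReal_one, one_mul]
    rw [e, ← h, hω]
    push_cast
    ring
  -- both `F` and `GQ ω` are periodic solutions of `opD L A 0 (·) = opD L A 0 F`; uniqueness
  have hFper : IsPeriodic (fineP L m) F := isPeriodic_comp_perSite (fineP L m) fun x => ⟪w, WL2.equiv ℂ _ W u x⟫_ℂ
  have hGper : IsPeriodic (fun i => L * m i) (GQ L A 0 m ω) := GQ_isPeriodic L A 0 hN ω
  have hkey : ∀ z, opD L A 0 (GQ L A 0 m ω) z = opD L A 0 F z := by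
    intro z
    have hP := period_pos L hN
    -- reduce to the period box by periodicity of both sides
    rw [← (hGper.opD L A 0).wrap_eq z, ← ((show IsPeriodic (fun i => L * m i) F from hFper).opD L A 0).wrap_eq z]
    set z₀ := wrap (fun i => L * m i) z with hz₀
    have hz₀box : z₀ ∈ box (fun i => L * m i) := wrap_mem_box hP z
    have hx : coarse L z₀ ∈ box m := coarse_mem_box L m hz₀box
    rw [hDF, ← finePt_coarse_offset L z₀, opD_GQ L hL1 A 0 hA0 le_rfl hN ω hx, coarse_finePt]
  obtain ⟨g, -, huniq⟩ := torusGreen_existsUnique L A 0 hA0 le_rfl hN (opD L A 0 F) (hFper.opD L A 0)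
  have h1 : F = g := huniq F ⟨hFper, fun _ => rfl⟩
  have h2 : GQ L A 0 m ω = g := huniq _ ⟨hGper, hkey⟩
  rw [h2, ← h1]

end Green

/-! ## §5 THE TRANSFER: b05's eigenvalue window for `Q′G′(1)²Q′^*` bounds the chain's third operator of [B9] Thm 3.11 from below -/

section Transfer

variable (L : ℕ) [NeZero L] (m : Fin (d + 1) → ℕ) [∀ i, NeZero (m i)] [∀ i, NeZero (fineP L m i)]
  {𝔸 : Type*} [Ring 𝔸] [Algebra ℂ 𝔸] {W : Type*} [NormedAddCommGroup W] [InnerProductSpace ℂ W] [FiniteDimensional ℂ W]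
  (φ : W ≃ₗ[ℂ] 𝔸) (c₀ : ℝ) [Fact (0 < c₀)] (η : ℝ) (c₁ : ℝ) [Fact (0 < c₁)]

omit [∀ i, NeZero (fineP L m i)] in
/-- **b05's TWO-SIDED FORM WINDOW IN THE `GQ` CURRENCY**: if `γ ≤ ev_{L,a,m}(k) ≤ Γ` at every dual momentum, then for every `ω`,
`L^{d+1}γΣ_{y∈T₁}‖ω(y)‖² ≤ Σ_{z∈T_ξ}‖(G′Q′^*ω)(z)‖² ≤ L^{d+1}ΓΣ_{y∈T₁}‖ω(y)‖²` (`gram_qggq`: `⟨ω, Q′G′²Q′^*ω⟩ = ξ^{d+1}Σ_z|G′Q′^*ω|²`; `form_qggq_bounds`).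
[cite: Balaban1984PropagatorsI, p.25 (paragraph after (1.44)), (1.45) p.26] -/
theorem sum_norm_sq_GQ_window {a γ Γ : ℝ} (hγ : ∀ k : (i : Fin (d + 1)) → Fin (m i), γ ≤ ev L a m k)
    (hΓ : ∀ k : (i : Fin (d + 1)) → Fin (m i), ev L a m k ≤ Γ) (ω : (Fin (d + 1) → ℤ) → ℂ) :
    (L : ℝ) ^ (d + 1) * (γ * ∑ y ∈ box m, ‖ω y‖ ^ 2) ≤ ∑ z ∈ box (fun i => L * m i), ‖GQ L a 0 m ω z‖ ^ 2 ∧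
      ∑ z ∈ box (fun i => L * m i), ‖GQ L a 0 m ω z‖ ^ 2 ≤ (L : ℝ) ^ (d + 1) * (Γ * ∑ y ∈ box m, ‖ω y‖ ^ 2) := by
  have hL1 : 1 ≤ L := Nat.one_le_iff_ne_zero.mpr (NeZero.ne L)
  have hN : ∀ i, 1 ≤ m i := fun i => Nat.one_le_iff_ne_zero.mpr (NeZero.ne (m i))
  have hLr : (0 : ℝ) < (L : ℝ) ^ (d + 1) := pow_pos (by exact_mod_cast Nat.pos_of_ne_zero (NeZero.ne L)) _
  -- `re⟨ω, Q′G′²Q′^*ω⟩ = L^{-(d+1)} Σ_z ‖GQ ω z‖²`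
  have hgram : (∑ y ∈ box m, ∑ y' ∈ box m, conj (ω y) * qggq L a 0 m y y' * ω y').re =
      ((L : ℝ) ^ (d + 1))⁻¹ * ∑ z ∈ box (fun i => L * m i), ‖GQ L a 0 m ω z‖ ^ 2 := by
    rw [gram_qggq]
    simp_rw [← Complex.ofReal_pow]
    rw [← Complex.ofReal_sum]
    have h2 : (((L : ℂ) ^ (d + 1))⁻¹ : ℂ) = ((((L : ℝ) ^ (d + 1))⁻¹ : ℝ) : ℂ) := by push_cast; rfl
    rw [h2, ← Complex.ofReal_mul, Complex.ofReal_re]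
  obtain ⟨h1, h2⟩ := form_qggq_bounds L hL1 a hN hγ hΓ ω
  rw [hgram] at h1 h2
  have e : ∀ t : ℝ, (L : ℝ) ^ (d + 1) * (((L : ℝ) ^ (d + 1))⁻¹ * t) = t := fun t => by rw [← mul_assoc, mul_inv_cancel₀ hLr.ne', one_mul]
  exact ⟨by simpa only [e] using mul_le_mul_of_nonneg_left h1 hLr.le, by simpa only [e] using mul_le_mul_of_nonneg_left h2 hLr.le⟩

omit [∀ i, NeZero (fineP L m i)] [NeZero L] in
/-- torus sums are period-box sums of the periodic reading. [cite: Balaban1985Averaging, (1) p.17; Balaban1983RegularityDecay, (1.6) p.572] -/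
theorem sum_univ_eq_sum_box_perSite {M : Type*} [AddCommMonoid M] (P : Fin (d + 1) → ℕ) [∀ i, NeZero (P i)] (g : TSite (d + 1) P → M) :
    ∑ x, g x = ∑ z ∈ box P, g (perSite P z) := by
  rw [sum_box_eq_sum_liftSite]
  exact Finset.sum_congr rfl fun x _ => by rw [perSite_liftSite]

/-- **THE TRANSFER, TWO-SIDED, IN THE `‖G′(1)Q̃′†ψ‖²` CURRENCY** (`η ≠ 0`): if `γ ≤ ev_{L,a,m}(k) ≤ Γ` at every dual momentum of the coarse torus,
`a = a′(ηL)²c₁∕(c₀L^{d+1})`, then `γ(ηL)⁴(c₁∕(c₀L^{d+1}))‖ψ‖² ≤ ‖G′(1)Q̃′†ψ‖² ≤ Γ(ηL)⁴(c₁∕(c₀L^{d+1}))‖ψ‖²` — fibre `W` split over `stdOrthonormalBasis`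
(`OrthonormalBasis.sum_sq_norm_inner_right`), each component identified with b05's `G′Q′^*ω_w` (§4), b05's window per component (`sum_norm_sq_GQ_window`).
[cite: Balaban1984PropagatorsI, (1.45) p.26, p.25; Balaban1985BackgroundPropagators, Thm 3.11 p.416, (3.25) p.394] -/
theorem norm_sq_green_adjoint_window (hη : η ≠ 0) {a' γ Γ : ℝ} (ha' : 0 < a')
    (hγ : ∀ k : (i : Fin (d + 1)) → Fin (m i), γ ≤ ev L (a' * (η * L) ^ 2 * (c₁ / (c₀ * (L : ℝ) ^ (d + 1)))) m k)
    (hΓ : ∀ k : (i : Fin (d + 1)) → Fin (m i), ev L (a' * (η * L) ^ 2 * (c₁ / (c₀ * (L : ℝ) ^ (d + 1)))) m k ≤ Γ)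
    (hpos' : ∀ x : SiteL2K ℂ (d + 1) (fineP L m) c₀ W, x ≠ 0 →
      0 < RCLike.re ⟪x, laplacePrimeA L m φ η (fun _ : Bond (d + 1) (fineP L m) => (1 : 𝔸ˣ)) a' (c₁ := c₁) x⟫_ℂ)
    (ψ : SiteL2K ℂ (d + 1) m c₁ W) :
    γ * (η * L) ^ 4 * (c₁ / (c₀ * (L : ℝ) ^ (d + 1))) * ‖ψ‖ ^ 2 ≤
        ‖GpOfU L m φ η (fun _ : Bond (d + 1) (fineP L m) => (1 : 𝔸ˣ)) a' (c₁ := c₁) hpos'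
          (LinearMap.adjoint ((WL2.linearEquiv ℂ ℂ (fun _ : TSite (d + 1) m => c₁)).symm.toLinearMap ∘ₗ
            QprimeW L m φ (fun _ : Bond (d + 1) (fineP L m) => (1 : 𝔸ˣ)) (c₀ := c₀)) ψ)‖ ^ 2 ∧
      ‖GpOfU L m φ η (fun _ : Bond (d + 1) (fineP L m) => (1 : 𝔸ˣ)) a' (c₁ := c₁) hpos'
          (LinearMap.adjoint ((WL2.linearEquiv ℂ ℂ (fun _ : TSite (d + 1) m => c₁)).symm.toLinearMap ∘ₗ
            QprimeW L m φ (fun _ : Bond (d + 1) (fineP L m) => (1 : 𝔸ˣ)) (c₀ := c₀)) ψ)‖ ^ 2 ≤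
        Γ * (η * L) ^ 4 * (c₁ / (c₀ * (L : ℝ) ^ (d + 1))) * ‖ψ‖ ^ 2 := by
  have hc₀ : 0 < c₀ := Fact.out
  have hc₁ : 0 < c₁ := Fact.out
  have hL0 : (0 : ℝ) < L := by exact_mod_cast Nat.pos_of_ne_zero (NeZero.ne L)
  set u := GpOfU L m φ η (fun _ : Bond (d + 1) (fineP L m) => (1 : 𝔸ˣ)) a' (c₁ := c₁) hpos'
    (LinearMap.adjoint ((WL2.linearEquiv ℂ ℂ (fun _ : TSite (d + 1) m => c₁)).symm.toLinearMap ∘ₗ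
      QprimeW L m φ (fun _ : Bond (d + 1) (fineP L m) => (1 : 𝔸ˣ)) (c₀ := c₀)) ψ) with hu
  set A : ℝ := a' * (η * L) ^ 2 * (c₁ / (c₀ * (L : ℝ) ^ (d + 1))) with hA
  set ρinv : ℝ := (η * L) ^ 2 * (c₁ / (c₀ * (L : ℝ) ^ (d + 1))) with hρ
  let b := stdOrthonormalBasis ℂ W
  set ωf : W → (Fin (d + 1) → ℤ) → ℂ := fun w z' => ((ρinv : ℝ) : ℂ) * ⟪w, WL2.equiv ℂ _ W ψ (perSite m z')⟫_ℂ with hωf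
  have hcomp : ∀ (w : W) (z : Fin (d + 1) → ℤ), ⟪w, WL2.equiv ℂ _ W u (perSite (fineP L m) z)⟫_ℂ = GQ L A 0 m (ωf w) z := fun w z =>
    congrFun (green_component_eq_GQ L m φ c₀ η c₁ hη ha' hpos' ψ w) z
  -- `‖u‖² = c₀ Σ_i Σ_{z ∈ T_ξ} ‖GQ (ωf (b i)) z‖²`
  have hnorm : ‖u‖ ^ 2 = c₀ * ∑ i, ∑ z ∈ box (fun i => L * m i), ‖GQ L A 0 m (ωf (b i)) z‖ ^ 2 := by
    rw [WL2.norm_sq, ← Finset.mul_sum, Finset.sum_comm]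
    congr 1
    rw [sum_univ_eq_sum_box_perSite (fineP L m)]
    refine Finset.sum_congr rfl fun z _ => ?_
    rw [← b.sum_sq_norm_inner_right]
    exact Finset.sum_congr rfl fun i _ => by rw [hcomp]
  -- `Σ_i Σ_{y ∈ T₁} ‖ωf (b i) y‖² = ρinv²·‖ψ‖²∕c₁`
  have hcoarse : ∑ i, ∑ y ∈ box m, ‖ωf (b i) y‖ ^ 2 = ρinv ^ 2 * (c₁⁻¹ * ‖ψ‖ ^ 2) := by
    have hψ : c₁⁻¹ * ‖ψ‖ ^ 2 = ∑ y, ‖WL2.equiv ℂ _ W ψ y‖ ^ 2 := by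
      rw [WL2.norm_sq, ← Finset.mul_sum, ← mul_assoc, inv_mul_cancel₀ hc₁.ne', one_mul]
    rw [hψ, Finset.sum_comm, sum_univ_eq_sum_box_perSite m, Finset.mul_sum]
    refine Finset.sum_congr rfl fun y _ => ?_
    rw [← b.sum_sq_norm_inner_right, Finset.mul_sum]
    refine Finset.sum_congr rfl fun i _ => ?_
    rw [hωf, norm_mul, mul_pow, Complex.norm_real, Real.norm_eq_abs, sq_abs]
  -- b05's window fibre by fibre, summed
  have hlo := Finset.sum_le_sum fun i (_ : i ∈ Finset.univ) => (sum_norm_sq_GQ_window L m hγ hΓ (ωf (b i))).1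
  have hhi := Finset.sum_le_sum fun i (_ : i ∈ Finset.univ) => (sum_norm_sq_GQ_window L m hγ hΓ (ωf (b i))).2
  rw [← Finset.mul_sum, ← Finset.mul_sum, hcoarse] at hlo hhi
  have e : ∀ t : ℝ, c₀ * ((L : ℝ) ^ (d + 1) * (t * (ρinv ^ 2 * (c₁⁻¹ * ‖ψ‖ ^ 2)))) =
      t * (η * L) ^ 4 * (c₁ / (c₀ * (L : ℝ) ^ (d + 1))) * ‖ψ‖ ^ 2 := fun t => by
    rw [hρ]; field_simp
  refine ⟨?_, ?_⟩
  · have h := mul_le_mul_of_nonneg_left hlo hc₀.le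
    rwa [← hnorm, e] at h
  · have h := mul_le_mul_of_nonneg_left hhi hc₀.le
    rwa [← hnorm, e] at h

/-- **(J-M-α) THE TRANSFER — b05's (1.45) MULTIPLIER WINDOW BOUNDS THE CHAIN's THIRD OPERATOR AT THE FLAT BACKGROUND FROM BELOW**: for every `γ`
below b05's eigenvalues `ev_{L, a, m}(k) = 𝒩_r(p′_k)∕E_r(p′_k)²` of `Q′G′(1)²Q′^*` on the coarse torus `Π_μ ℤ∕m_μ` (`a = a′(ηL)²c₁∕(c₀L^{d+1})`), every coarse
`ψ : SiteL2K ℂ (d+1) m c₁ W` satisfies `γ·(ηL)⁴·(c₁∕(c₀L^{d+1}))·‖ψ‖² ≤ re⟪ψ, (Q̃′∘G′(1)∘G′(1)∘Q̃′†)ψ⟫ = ‖G′(1)Q̃′†ψ‖²` — the operator of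
`B9Eq365QGGQLowerVariational.qggq_coercive_flat` VERBATIM (`Q̃′ = (WL2.linearEquiv …).symm ∘ QprimeW L m φ 1`, `G′(1) = GpOfU … hpos′`); at `η = 0` the
left side vanishes. [cite: Balaban1984PropagatorsI, (1.45) p.26, p.25; Balaban1985BackgroundPropagators, Thm 3.11 p.416, (3.25) p.394] -/
theorem qggq_flat_symbol_transfer {a' γ : ℝ} (ha' : 0 < a')
    (hγ : ∀ k : (i : Fin (d + 1)) → Fin (m i), γ ≤ ev L (a' * (η * L) ^ 2 * (c₁ / (c₀ * (L : ℝ) ^ (d + 1)))) m k)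
    (hpos' : ∀ x : SiteL2K ℂ (d + 1) (fineP L m) c₀ W, x ≠ 0 →
      0 < RCLike.re ⟪x, laplacePrimeA L m φ η (fun _ : Bond (d + 1) (fineP L m) => (1 : 𝔸ˣ)) a' (c₁ := c₁) x⟫_ℂ)
    (ψ : SiteL2K ℂ (d + 1) m c₁ W) :
    γ * (η * L) ^ 4 * (c₁ / (c₀ * (L : ℝ) ^ (d + 1))) * ‖ψ‖ ^ 2 ≤ RCLike.re ⟪ψ, (((WL2.linearEquiv ℂ ℂ (fun _ : TSite (d + 1) m => c₁)).symm.toLinearMap ∘ₗ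
          QprimeW L m φ (fun _ : Bond (d + 1) (fineP L m) => (1 : 𝔸ˣ)) (c₀ := c₀)) ∘ₗ
        GpOfU L m φ η (fun _ : Bond (d + 1) (fineP L m) => (1 : 𝔸ˣ)) a' (c₁ := c₁) hpos' ∘ₗ
        GpOfU L m φ η (fun _ : Bond (d + 1) (fineP L m) => (1 : 𝔸ˣ)) a' (c₁ := c₁) hpos' ∘ₗ
        LinearMap.adjoint ((WL2.linearEquiv ℂ ℂ (fun _ : TSite (d + 1) m => c₁)).symm.toLinearMap ∘ₗ
          QprimeW L m φ (fun _ : Bond (d + 1) (fineP L m) => (1 : 𝔸ˣ)) (c₀ := c₀))) ψ⟫_ℂ := by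
  set Qℓ := (WL2.linearEquiv ℂ ℂ (fun _ : TSite (d + 1) m => c₁)).symm.toLinearMap ∘ₗ
    QprimeW L m φ (fun _ : Bond (d + 1) (fineP L m) => (1 : 𝔸ˣ)) (c₀ := c₀) with hQℓ
  set T := laplacePrimeA L m φ η (fun _ : Bond (d + 1) (fineP L m) => (1 : 𝔸ˣ)) a' (c₀ := c₀) (c₁ := c₁) with hT
  have hTs : T.IsSymmetric := laplacePrimeA_isSymmetric L m φ c₀ η _ c₁ a' (hRS_one φ)
  have hG : ∀ z, GpOfU L m φ η (fun _ : Bond (d + 1) (fineP L m) => (1 : 𝔸ˣ)) a' (c₁ := c₁) hpos' z = greenK T hpos' z := fun z => rfl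
  -- `re⟪ψ, Q̃′G′G′Q̃′†ψ⟫ = ‖G′Q̃′†ψ‖²`
  have hform : RCLike.re ⟪ψ, (Qℓ ∘ₗ GpOfU L m φ η (fun _ : Bond (d + 1) (fineP L m) => (1 : 𝔸ˣ)) a' (c₁ := c₁) hpos' ∘ₗ
      GpOfU L m φ η (fun _ : Bond (d + 1) (fineP L m) => (1 : 𝔸ˣ)) a' (c₁ := c₁) hpos' ∘ₗ LinearMap.adjoint Qℓ) ψ⟫_ℂ =
      ‖GpOfU L m φ η (fun _ : Bond (d + 1) (fineP L m) => (1 : 𝔸ˣ)) a' (c₁ := c₁) hpos' (LinearMap.adjoint Qℓ ψ)‖ ^ 2 := by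
    simp only [LinearMap.comp_apply, hG]
    rw [inner_qggq_eq_norm_sq hTs hpos' Qℓ ψ, ← RCLike.ofReal_pow, RCLike.ofReal_re]
  rw [hform]
  by_cases hη : η = 0
  · have h0 : γ * (η * L) ^ 4 * (c₁ / (c₀ * (L : ℝ) ^ (d + 1))) * ‖ψ‖ ^ 2 = 0 := by rw [hη]; ring
    rw [h0]
    positivity
  · exact (norm_sq_green_adjoint_window L m φ c₀ η c₁ hη ha' hγ
      (Γ := Finset.univ.sup' ⟨fun i => ⟨0, Nat.pos_of_ne_zero (NeZero.ne (m i))⟩, Finset.mem_univ _⟩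
        (ev L (a' * (η * L) ^ 2 * (c₁ / (c₀ * (L : ℝ) ^ (d + 1)))) m))
      (fun k => Finset.le_sup' (ev L (a' * (η * L) ^ 2 * (c₁ / (c₀ * (L : ℝ) ^ (d + 1)))) m) (Finset.mem_univ k)) hpos' ψ).1

/-- **THE UPPER COMPANION** (`η ≠ 0`; b05's window is two-sided — not needed by the Chain, asked for KAPPA1's cross-check and (3.65)'s upper letter,
t4-ne9-idea-1 g95 W-6 (a)): `re⟪ψ, Q̃′G′(1)²Q̃′†ψ⟫ ≤ Γ·(ηL)⁴·(c₁∕(c₀L^{d+1}))·‖ψ‖²` for every `Γ ≥ ev_{L, a, m}`. [cite: Balaban1984PropagatorsI, (1.45) p.26, p.26 (the sentence after (1.45): «… ≦ γ₁»); Balaban1985BackgroundPropagators, Thm 3.11 p.416, (3.65) p.403] -/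
theorem qggq_flat_symbol_transfer_upper (hη : η ≠ 0) {a' Γ : ℝ} (ha' : 0 < a')
    (hΓ : ∀ k : (i : Fin (d + 1)) → Fin (m i), ev L (a' * (η * L) ^ 2 * (c₁ / (c₀ * (L : ℝ) ^ (d + 1)))) m k ≤ Γ)
    (hpos' : ∀ x : SiteL2K ℂ (d + 1) (fineP L m) c₀ W, x ≠ 0 →
      0 < RCLike.re ⟪x, laplacePrimeA L m φ η (fun _ : Bond (d + 1) (fineP L m) => (1 : 𝔸ˣ)) a' (c₁ := c₁) x⟫_ℂ)
    (ψ : SiteL2K ℂ (d + 1) m c₁ W) :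
    RCLike.re ⟪ψ, (((WL2.linearEquiv ℂ ℂ (fun _ : TSite (d + 1) m => c₁)).symm.toLinearMap ∘ₗ
          QprimeW L m φ (fun _ : Bond (d + 1) (fineP L m) => (1 : 𝔸ˣ)) (c₀ := c₀)) ∘ₗ
        GpOfU L m φ η (fun _ : Bond (d + 1) (fineP L m) => (1 : 𝔸ˣ)) a' (c₁ := c₁) hpos' ∘ₗ
        GpOfU L m φ η (fun _ : Bond (d + 1) (fineP L m) => (1 : 𝔸ˣ)) a' (c₁ := c₁) hpos' ∘ₗ
        LinearMap.adjoint ((WL2.linearEquiv ℂ ℂ (fun _ : TSite (d + 1) m => c₁)).symm.toLinearMap ∘ₗ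
          QprimeW L m φ (fun _ : Bond (d + 1) (fineP L m) => (1 : 𝔸ˣ)) (c₀ := c₀))) ψ⟫_ℂ ≤ Γ * (η * L) ^ 4 * (c₁ / (c₀ * (L : ℝ) ^ (d + 1))) * ‖ψ‖ ^ 2 := by
  set Qℓ := (WL2.linearEquiv ℂ ℂ (fun _ : TSite (d + 1) m => c₁)).symm.toLinearMap ∘ₗ
    QprimeW L m φ (fun _ : Bond (d + 1) (fineP L m) => (1 : 𝔸ˣ)) (c₀ := c₀) with hQℓ
  set T := laplacePrimeA L m φ η (fun _ : Bond (d + 1) (fineP L m) => (1 : 𝔸ˣ)) a' (c₀ := c₀) (c₁ := c₁) with hT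
  have hTs : T.IsSymmetric := laplacePrimeA_isSymmetric L m φ c₀ η _ c₁ a' (hRS_one φ)
  have hG : ∀ z, GpOfU L m φ η (fun _ : Bond (d + 1) (fineP L m) => (1 : 𝔸ˣ)) a' (c₁ := c₁) hpos' z = greenK T hpos' z := fun z => rfl
  have hform : RCLike.re ⟪ψ, (Qℓ ∘ₗ GpOfU L m φ η (fun _ : Bond (d + 1) (fineP L m) => (1 : 𝔸ˣ)) a' (c₁ := c₁) hpos' ∘ₗ
      GpOfU L m φ η (fun _ : Bond (d + 1) (fineP L m) => (1 : 𝔸ˣ)) a' (c₁ := c₁) hpos' ∘ₗ LinearMap.adjoint Qℓ) ψ⟫_ℂ =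
      ‖GpOfU L m φ η (fun _ : Bond (d + 1) (fineP L m) => (1 : 𝔸ˣ)) a' (c₁ := c₁) hpos' (LinearMap.adjoint Qℓ ψ)‖ ^ 2 := by
    simp only [LinearMap.comp_apply, hG]
    rw [inner_qggq_eq_norm_sq hTs hpos' Qℓ ψ, ← RCLike.ofReal_pow, RCLike.ofReal_re]
  rw [hform]
  exact (norm_sq_green_adjoint_window L m φ c₀ η c₁ hη ha'
    (γ := Finset.univ.inf' ⟨fun i => ⟨0, Nat.pos_of_ne_zero (NeZero.ne (m i))⟩, Finset.mem_univ _⟩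
      (ev L (a' * (η * L) ^ 2 * (c₁ / (c₀ * (L : ℝ) ^ (d + 1)))) m))
    (fun k => Finset.inf'_le (ev L (a' * (η * L) ^ 2 * (c₁ / (c₀ * (L : ℝ) ^ (d + 1)))) m) (Finset.mem_univ k)) hΓ hpos' ψ).2

/-- **ON THE DIAGONAL `ηL = 1` WITH THE CANONICAL WEIGHTS `c₀L^{d+1} = c₁`** (`Q̃′Q̃′† = 1`; b05's `a` IS the chain's `a′`): every lower bound `γ` of
b05's eigenvalues `ev_{L, a′, m}` is a lower bound of the chain's `Q̃′G′(1)²Q̃′†` — `γ·‖ψ‖² ≤ re⟪ψ, Q̃′G′(1)²Q̃′†ψ⟫`; in particular the EXACT flat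
constant `κ(1) = min_k ev_{L, a′, m}(k)` drops into the `hκ₀` slot of the chain's `R`-Lipschitz letters. [cite: Balaban1984PropagatorsI, (1.45) p.26; Balaban1985BackgroundPropagators, Thm 3.11 p.416, (3.25) p.394, (3.35) p.396] -/
theorem qggq_flat_symbol_transfer_diagonal {a' γ : ℝ} (ha' : 0 < a') (hηL : η * L = 1) (hw : c₀ * (L : ℝ) ^ (d + 1) = c₁)
    (hγ : ∀ k : (i : Fin (d + 1)) → Fin (m i), γ ≤ ev L a' m k)
    (hpos' : ∀ x : SiteL2K ℂ (d + 1) (fineP L m) c₀ W, x ≠ 0 →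
      0 < RCLike.re ⟪x, laplacePrimeA L m φ η (fun _ : Bond (d + 1) (fineP L m) => (1 : 𝔸ˣ)) a' (c₁ := c₁) x⟫_ℂ)
    (ψ : SiteL2K ℂ (d + 1) m c₁ W) :
    γ * ‖ψ‖ ^ 2 ≤ RCLike.re ⟪ψ, (((WL2.linearEquiv ℂ ℂ (fun _ : TSite (d + 1) m => c₁)).symm.toLinearMap ∘ₗ
          QprimeW L m φ (fun _ : Bond (d + 1) (fineP L m) => (1 : 𝔸ˣ)) (c₀ := c₀)) ∘ₗ
        GpOfU L m φ η (fun _ : Bond (d + 1) (fineP L m) => (1 : 𝔸ˣ)) a' (c₁ := c₁) hpos' ∘ₗ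
        GpOfU L m φ η (fun _ : Bond (d + 1) (fineP L m) => (1 : 𝔸ˣ)) a' (c₁ := c₁) hpos' ∘ₗ
        LinearMap.adjoint ((WL2.linearEquiv ℂ ℂ (fun _ : TSite (d + 1) m => c₁)).symm.toLinearMap ∘ₗ
          QprimeW L m φ (fun _ : Bond (d + 1) (fineP L m) => (1 : 𝔸ˣ)) (c₀ := c₀))) ψ⟫_ℂ := by
  have hc₁ : 0 < c₁ := Fact.out
  have hρ : c₁ / (c₀ * (L : ℝ) ^ (d + 1)) = 1 := by rw [hw, div_self hc₁.ne']
  have h := qggq_flat_symbol_transfer L m φ c₀ η c₁ (γ := γ) ha' (by rwa [hηL, hρ, one_pow, mul_one, mul_one]) hpos' ψ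
  rwa [hηL, hρ, one_pow, mul_one, mul_one] at h

/-- **THE EXACT FLAT CONSTANT AS A TYPED MINIMUM**: on the diagonal, `(min_k ev_{L, a′, m}(k))·‖ψ‖² ≤ re⟪ψ, Q̃′G′(1)²Q̃′†ψ⟫` — `κ(1) = min_k ev` of
`t4/ROUTES-NE9.md` v13.31 (iv), VOLUME by VOLUME (the minimum over the dual momenta of the coarse torus `Π_μ ℤ∕m_μ`). [cite: Balaban1984PropagatorsI, (1.45) p.26; Balaban1985BackgroundPropagators, Thm 3.11 p.416] -/
theorem qggq_flat_min_ev_le {a' : ℝ} (ha' : 0 < a') (hηL : η * L = 1) (hw : c₀ * (L : ℝ) ^ (d + 1) = c₁)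
    (hpos' : ∀ x : SiteL2K ℂ (d + 1) (fineP L m) c₀ W, x ≠ 0 →
      0 < RCLike.re ⟪x, laplacePrimeA L m φ η (fun _ : Bond (d + 1) (fineP L m) => (1 : 𝔸ˣ)) a' (c₁ := c₁) x⟫_ℂ)
    (ψ : SiteL2K ℂ (d + 1) m c₁ W) :
    Finset.univ.inf' ⟨fun i => ⟨0, Nat.pos_of_ne_zero (NeZero.ne (m i))⟩, Finset.mem_univ _⟩ (ev L a' m) * ‖ψ‖ ^ 2 ≤
      RCLike.re ⟪ψ, (((WL2.linearEquiv ℂ ℂ (fun _ : TSite (d + 1) m => c₁)).symm.toLinearMap ∘ₗ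
          QprimeW L m φ (fun _ : Bond (d + 1) (fineP L m) => (1 : 𝔸ˣ)) (c₀ := c₀)) ∘ₗ
        GpOfU L m φ η (fun _ : Bond (d + 1) (fineP L m) => (1 : 𝔸ˣ)) a' (c₁ := c₁) hpos' ∘ₗ
        GpOfU L m φ η (fun _ : Bond (d + 1) (fineP L m) => (1 : 𝔸ˣ)) a' (c₁ := c₁) hpos' ∘ₗ
        LinearMap.adjoint ((WL2.linearEquiv ℂ ℂ (fun _ : TSite (d + 1) m => c₁)).symm.toLinearMap ∘ₗ
          QprimeW L m φ (fun _ : Bond (d + 1) (fineP L m) => (1 : 𝔸ˣ)) (c₀ := c₀))) ψ⟫_ℂ :=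
  qggq_flat_symbol_transfer_diagonal L m φ c₀ η c₁ ha' hηL hw (fun k => Finset.inf'_le _ (Finset.mem_univ k)) hpos' ψ

/-- **THE SAME WITH THE POSITIVITY DISCHARGED** (`B9Thm311DeltaPrimeA.laplacePrimeA_one_pos`: `η ≠ 0`, `a′ > 0` only): the operator of ne9-leaf-06's
`B9Eq325ProjFormula.QGGQ_pos_one` VERBATIM is bounded below by `γ(ηL)⁴(c₁∕(c₀L^{d+1}))` for every `γ ≤ ev_{L, a, m}` — no displayed letter of the chain left
at the flat background. [cite: Balaban1984PropagatorsI, (1.45) p.26; Balaban1985BackgroundPropagators, Thm 3.11 p.416, (3.25) p.394] -/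
theorem qggq_flat_symbol_transfer_one {a' γ : ℝ} (hη : η ≠ 0) (ha' : 0 < a')
    (hγ : ∀ k : (i : Fin (d + 1)) → Fin (m i), γ ≤ ev L (a' * (η * L) ^ 2 * (c₁ / (c₀ * (L : ℝ) ^ (d + 1)))) m k)
    (ψ : SiteL2K ℂ (d + 1) m c₁ W) :
    γ * (η * L) ^ 4 * (c₁ / (c₀ * (L : ℝ) ^ (d + 1))) * ‖ψ‖ ^ 2 ≤ RCLike.re ⟪ψ, (((WL2.linearEquiv ℂ ℂ (fun _ : TSite (d + 1) m => c₁)).symm.toLinearMap ∘ₗ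
          QprimeW L m φ (fun _ : Bond (d + 1) (fineP L m) => (1 : 𝔸ˣ)) (c₀ := c₀)) ∘ₗ
        GpOfU L m φ η (fun _ : Bond (d + 1) (fineP L m) => (1 : 𝔸ˣ)) a' (c₁ := c₁) (laplacePrimeA_one_pos L m φ η a' hη ha') ∘ₗ
        GpOfU L m φ η (fun _ : Bond (d + 1) (fineP L m) => (1 : 𝔸ˣ)) a' (c₁ := c₁) (laplacePrimeA_one_pos L m φ η a' hη ha') ∘ₗ
        LinearMap.adjoint ((WL2.linearEquiv ℂ ℂ (fun _ : TSite (d + 1) m => c₁)).symm.toLinearMap ∘ₗ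
          QprimeW L m φ (fun _ : Bond (d + 1) (fineP L m) => (1 : 𝔸ˣ)) (c₀ := c₀))) ψ⟫_ℂ :=
  qggq_flat_symbol_transfer L m φ c₀ η c₁ ha' hγ _ ψ

/-- **THE CONSUMER's SLOT, LITERALLY**: on the diagonal `ηL = 1`, `c₀L^{d+1} = c₁`, with `hpos′` discharged, every `γ ≤ ev_{L, a′, m}` inhabits the
`hκ1 : ∀ ψ, κ₀‖ψ‖² ≤ re⟪ψ, Q̃′G′(1)²Q̃′†ψ⟫` binder of ne9-leaf-06's `B9Eq325RLipschitzClosed.norm_RofU_sub_RofU_one_le_of_letters` with `κ₀ := γ` (e.g.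
`γ := min_k ev` or b05's uniform `γ₀`) — at dimension `d+1`. [cite: Balaban1984PropagatorsI, (1.45) p.26; Balaban1985BackgroundPropagators, Thm 3.11 p.416, (3.25) p.394] -/
theorem qggq_flat_symbol_transfer_one_diagonal {a' γ : ℝ} (hη : η ≠ 0) (ha' : 0 < a') (hηL : η * L = 1)
    (hw : c₀ * (L : ℝ) ^ (d + 1) = c₁) (hγ : ∀ k : (i : Fin (d + 1)) → Fin (m i), γ ≤ ev L a' m k) (ψ : SiteL2K ℂ (d + 1) m c₁ W) :
    γ * ‖ψ‖ ^ 2 ≤ RCLike.re ⟪ψ, (((WL2.linearEquiv ℂ ℂ (fun _ : TSite (d + 1) m => c₁)).symm.toLinearMap ∘ₗ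
          QprimeW L m φ (fun _ : Bond (d + 1) (fineP L m) => (1 : 𝔸ˣ)) (c₀ := c₀)) ∘ₗ
        GpOfU L m φ η (fun _ : Bond (d + 1) (fineP L m) => (1 : 𝔸ˣ)) a' (c₁ := c₁) (laplacePrimeA_one_pos L m φ η a' hη ha') ∘ₗ
        GpOfU L m φ η (fun _ : Bond (d + 1) (fineP L m) => (1 : 𝔸ˣ)) a' (c₁ := c₁) (laplacePrimeA_one_pos L m φ η a' hη ha') ∘ₗ
        LinearMap.adjoint ((WL2.linearEquiv ℂ ℂ (fun _ : TSite (d + 1) m => c₁)).symm.toLinearMap ∘ₗ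
          QprimeW L m φ (fun _ : Bond (d + 1) (fineP L m) => (1 : 𝔸ˣ)) (c₀ := c₀))) ψ⟫_ℂ :=
  qggq_flat_symbol_transfer_diagonal L m φ c₀ η c₁ ha' hηL hw hγ _ ψ

/-- **b05's UNIFORM WINDOW, TRANSPORTED: ONE `γ₀ = γ₀(d, a₋, a₊) > 0` FOR ALL `L ≥ 1`, ALL VOLUMES `m`, ALL `a′ ∈ [a₋, a₊]`** on the diagonal
`ηL = 1`, `c₀L^{d+1} = c₁`: `γ₀·‖ψ‖² ≤ re⟪ψ, Q̃′G′(1)²Q̃′†ψ⟫` — [B5] p. 26 «γ₀ ≦ Q′_kG′_k²Q′_k^*» (the cell's `B5QGGQ145Bounds.ev_window`, constants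
from the `k`-uniform strip for (1.45); HONEST SCOPE there: "γ₀ dependent only on d" is NOT asserted — `γ₀` carries the `a`-window). [cite: Balaban1984PropagatorsI, p.26 (the sentence after (1.45)); Balaban1985BackgroundPropagators, Thm 3.11 p.416] -/
theorem exists_uniform_qggq_flat_lower_bound (aminus aplus : ℝ) (ha : 0 < aminus) :
    ∃ γ₀ : ℝ, 0 < γ₀ ∧ ∀ (L : ℕ) [NeZero L] (m : Fin (d + 1) → ℕ) [∀ i, NeZero (m i)] [∀ i, NeZero (fineP L m i)]
      (c₀ : ℝ) [Fact (0 < c₀)] (η : ℝ) (c₁ : ℝ) [Fact (0 < c₁)] (a' : ℝ), aminus ≤ a' → a' ≤ aplus → η * L = 1 →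
      c₀ * (L : ℝ) ^ (d + 1) = c₁ →
      ∀ (hpos' : ∀ x : SiteL2K ℂ (d + 1) (fineP L m) c₀ W, x ≠ 0 →
      0 < RCLike.re ⟪x, laplacePrimeA L m φ η (fun _ : Bond (d + 1) (fineP L m) => (1 : 𝔸ˣ)) a' (c₁ := c₁) x⟫_ℂ)
        (ψ : SiteL2K ℂ (d + 1) m c₁ W),
        γ₀ * ‖ψ‖ ^ 2 ≤ RCLike.re ⟪ψ, (((WL2.linearEquiv ℂ ℂ (fun _ : TSite (d + 1) m => c₁)).symm.toLinearMap ∘ₗ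
          QprimeW L m φ (fun _ : Bond (d + 1) (fineP L m) => (1 : 𝔸ˣ)) (c₀ := c₀)) ∘ₗ
        GpOfU L m φ η (fun _ : Bond (d + 1) (fineP L m) => (1 : 𝔸ˣ)) a' (c₁ := c₁) hpos' ∘ₗ
        GpOfU L m φ η (fun _ : Bond (d + 1) (fineP L m) => (1 : 𝔸ˣ)) a' (c₁ := c₁) hpos' ∘ₗ
        LinearMap.adjoint ((WL2.linearEquiv ℂ ℂ (fun _ : TSite (d + 1) m => c₁)).symm.toLinearMap ∘ₗ
          QprimeW L m φ (fun _ : Bond (d + 1) (fineP L m) => (1 : 𝔸ˣ)) (c₀ := c₀))) ψ⟫_ℂ := by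
  obtain ⟨γ₀, γ₁, h0, -, h⟩ := ev_window d aminus aplus ha
  refine ⟨γ₀, h0, fun L _ m _ _ c₀ _ η c₁ _ a' ha1 ha2 hηL hw hpos' ψ => ?_⟩
  have hL1 : 1 ≤ L := Nat.one_le_iff_ne_zero.mpr (NeZero.ne L)
  exact qggq_flat_symbol_transfer_diagonal L m φ c₀ η c₁ (lt_of_lt_of_le ha ha1) hηL hw (fun k => (h L hL1 a' ha1 ha2 m k).1) hpos' ψ

end Transfer

end Literature.MathematicalPhysics.QuantumFieldTheory.Balaban1983to89.B9Eq365QGGQFlatSymbolTransfer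

end
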